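import Mathlib.Data.Real.Basic
import Mathlib.Tactic.Linarith
import Mathlib.Tactic.Positivity
import Mathlib.Tactic.Ring
import HarnessLib

/-!
# QUANT lane R8, front "FAR beyond trees", layer one — THE HAIRED EAR AT THE OBSERVER, V: the bookkeeping certificates

builds on p205010 (kernel theorem, internal audit signed; external expert review pending)

Support file (`--supports stmt-CriticalPhenomena-4575`), seat `prim-quant-p1` (gen 27); memo
`run/shared/lean/prim/quant/prim-quant-p1-g27/FOR-LEAD-HAIR.md` §2.  Pure real arithmetic; standard axioms; no sorries; no definitions.

THE BOOKKEEPING INEQUALITY.  Cells `x₀₀, x₀₁, a₁, a₂, c, d₁, d₂ ≥ 0` (sum `1`, `g = c + d₁ + d₂`), pair weights `p, r, s ∈ [0,1]`,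
`W = (1−p)(1−r)`, `N ≥ 1` outside relays; `P = P(N ≥ 2) = prs·x₀₀ + pr·x₀₁ + p·a₁ + a₂ + (1−W)s·c + (1 − W(1−s))·d₁ + d₂`,
marginals `q_v = p + (1−p) r g`, `q_h = s(pr + (1−pr) g)`, outside sum `S` with `N x ≤ S ≤ S_ub = prN·x₀₁ + (1−pr+prN)·a₁ + N·a₂ + d₁ + N·d₂`,
threshold `x ≤ q_v, q_h`, mean `q_v + q_h + S > 2`, Harris `g·(a₁ + a₂ + d₁ + d₂) ≤ d₁ + d₂`.  CLAIM: `x ≤ P`.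
This file proves the certificates (each an exact polynomial identity `Σ multipliers × (hypothesis slacks) = Σ coefficient × cell`
plus the sign conditions of its regime); `…EarHairArithCover` proves that the regimes cover, `…EarHairArithMaster` assembles:
* `EarHair.arith_M0` — regime `A₁ ≥ 0`: `N(1−W)(P − q_h) + W(N P − S_ub) ≥ 0` coefficientwise (no mean, no Harris);
* `EarHair.arith_M4` — `A₁ < 0`, `g` large: the same combination minus `Ā·`(Harris slack);
* `EarHair.arith_M1` — `(W + 1 − s)(P − q_h) − sW(EN − 2) ≥ 0` coefficientwise;
* `EarHair.arith_M3` / `arith_M3one` / `arith_M3top` — `N(1−g)(P − q_v) − (1−g)Φ(EN − 2) − K̃(c + d₁ + d₂ − g) ≥ 0` coefficientwise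
  (`Φ = 1 − s + sW`), its one-outside-relay variant, and the degenerate corner `g = 1`.
[this work]; the inequality served is the layer-one row of [cite: KozmaNitzan2024, Conjecture 3 (p. 15)].
-/

namespace Summit.CriticalPhenomena.PercolationContinuityZ3.Theorems

namespace Quant

namespace EarHair

/-- **Certificate M0** (regime `A₁ ≥ 0`, with `A₂ ≥ 0`): compare `P` with the convex combination `(1−W)·q_h + W·S/N`. [this work] -/
theorem arith_M0 {p r s W N x S g x00 x01 a1 a2 c d1 d2 P qh Sub : ℝ}
    (hp0 : 0 ≤ p) (hp1 : p ≤ 1) (hr0 : 0 ≤ r) (hr1 : r ≤ 1) (hs0 : 0 ≤ s) (hs1 : s ≤ 1)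
    (hW : W = (1 - p) * (1 - r)) (hW0 : 0 ≤ W) (hW1 : W ≤ 1)
    (hN : 0 < N) (hx00 : 0 ≤ x00) (hx01 : 0 ≤ x01) (ha1 : 0 ≤ a1) (ha2 : 0 ≤ a2) (hd1 : 0 ≤ d1) (hd2 : 0 ≤ d2)
    (hone : x00 + x01 + a1 + a2 + c + d1 + d2 = 1) (hg : g = c + d1 + d2)
    (hP : P = p * r * s * x00 + p * r * x01 + p * a1 + a2 + (1 - W) * s * c + (1 - W * (1 - s)) * d1 + d2)
    (hqh : qh = s * (p * r + (1 - p * r) * g)) (hSubd : Sub = p * r * N * x01 + (1 - p * r + p * r * N) * a1 + N * a2 + d1 + N * d2)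
    (hA1 : 0 ≤ N * p * ((1 - W) * (1 - r * s) + W * (1 - r)) - W * (1 - p * r))
    (hA2 : 0 ≤ N * ((1 - W) ^ 2 * (1 - s) + W * (1 - W * (1 - s))) - W)
    (hxh : x ≤ qh) (hSx : N * x ≤ S) (hSub : S ≤ Sub) : x ≤ P := by
  have hpr : 0 ≤ p * r := mul_nonneg hp0 hr0
  have hprs1 : p * r * s ≤ 1 := by
    have h1 : p * r ≤ 1 := by nlinarith
    nlinarith
  have id : N * (1 - W) * ((p * r * s * x00 + p * r * x01 + p * a1 + a2 + (1 - W) * s * c + (1 - W * (1 - s)) * d1 + d2) -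
        s * (p * r * (x00 + x01 + a1 + a2 + c + d1 + d2) + (1 - p * r) * (c + d1 + d2))) +
      W * (N * (p * r * s * x00 + p * r * x01 + p * a1 + a2 + (1 - W) * s * c + (1 - W * (1 - s)) * d1 + d2) -
        (p * r * N * x01 + (1 - p * r + p * r * N) * a1 + N * a2 + d1 + N * d2)) =
      N * W * (p * r) * s * x00 + N * (1 - W) * (p * r) * (1 - s) * x01 +
        (N * p * ((1 - W) * (1 - r * s) + W * (1 - r)) - W * (1 - p * r)) * a1 + N * (1 - W) * (1 - p * r * s) * a2 +
        (N * ((1 - W) ^ 2 * (1 - s) + W * (1 - W * (1 - s))) - W) * d1 + N * (1 - W) * (1 - s) * d2 := by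
    subst hW; ring
  have e1 : s * (p * r * (x00 + x01 + a1 + a2 + c + d1 + d2) + (1 - p * r) * (c + d1 + d2)) = qh := by rw [hqh, hg, hone]; ring
  rw [e1, ← hP, ← hSubd] at id
  have t1 : 0 ≤ N * W * (p * r) * s * x00 := mul_nonneg (mul_nonneg (mul_nonneg (mul_nonneg hN.le hW0) hpr) hs0) hx00
  have t2 : 0 ≤ N * (1 - W) * (p * r) * (1 - s) * x01 :=
    mul_nonneg (mul_nonneg (mul_nonneg (mul_nonneg hN.le (by linarith)) hpr) (by linarith)) hx01
  have t3 : 0 ≤ (N * p * ((1 - W) * (1 - r * s) + W * (1 - r)) - W * (1 - p * r)) * a1 := mul_nonneg hA1 ha1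
  have t4 : 0 ≤ N * (1 - W) * (1 - p * r * s) * a2 := mul_nonneg (mul_nonneg (mul_nonneg hN.le (by linarith)) (by linarith)) ha2
  have t5 : 0 ≤ (N * ((1 - W) ^ 2 * (1 - s) + W * (1 - W * (1 - s))) - W) * d1 := mul_nonneg hA2 hd1
  have t6 : 0 ≤ N * (1 - W) * (1 - s) * d2 := mul_nonneg (mul_nonneg (mul_nonneg hN.le (by linarith)) (by linarith)) hd2
  have hkey : 0 ≤ N * (1 - W) * (P - qh) + W * (N * P - Sub) := by rw [id]; linarith
  have h1 : N * (1 - W) * (P - qh) ≤ N * (1 - W) * (P - x) := mul_le_mul_of_nonneg_left (by linarith) (mul_nonneg hN.le (by linarith))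
  have h2 : W * (N * P - Sub) ≤ W * (N * P - N * x) := mul_le_mul_of_nonneg_left (by linarith) hW0
  have h3 : N * (1 - W) * (P - x) + W * (N * P - N * x) = N * (P - x) := by ring
  have h4 : 0 ≤ N * (P - x) := by linarith
  have h5 := (mul_nonneg_iff_of_pos_left hN).1 h4
  linarith

/-- **Certificate M4** (regime `A₁ < 0`, `g` large, i.e. `L₁, L₂ ≥ 0`): as M0, with the `a₁` deficit paid by Harris' inequality. [this work] -/
theorem arith_M4 {p r s W N x S g x00 x01 a1 a2 c d1 d2 P qh Sub : ℝ}
    (hp0 : 0 ≤ p) (hp1 : p ≤ 1) (hr0 : 0 ≤ r) (hr1 : r ≤ 1) (hs0 : 0 ≤ s) (hs1 : s ≤ 1)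
    (hW : W = (1 - p) * (1 - r)) (hW0 : 0 ≤ W) (hW1 : W ≤ 1)
    (hN : 0 < N) (hx00 : 0 ≤ x00) (hx01 : 0 ≤ x01) (ha2 : 0 ≤ a2) (hd1 : 0 ≤ d1) (hd2 : 0 ≤ d2)
    (hone : x00 + x01 + a1 + a2 + c + d1 + d2 = 1) (hg : g = c + d1 + d2) (hg0 : 0 < g)
    (hP : P = p * r * s * x00 + p * r * x01 + p * a1 + a2 + (1 - W) * s * c + (1 - W * (1 - s)) * d1 + d2)
    (hqh : qh = s * (p * r + (1 - p * r) * g)) (hSubd : Sub = p * r * N * x01 + (1 - p * r + p * r * N) * a1 + N * a2 + d1 + N * d2)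
    (hA1 : N * p * ((1 - W) * (1 - r * s) + W * (1 - r)) - W * (1 - p * r) ≤ 0)
    (hL1 : 0 ≤ g * (N * ((1 - W) ^ 2 * (1 - s) + W * (1 - W * (1 - s))) - W) +
      (N * p * ((1 - W) * (1 - r * s) + W * (1 - r)) - W * (1 - p * r)) * (1 - g))
    (hL2 : 0 ≤ N * g * (1 - W) * (1 - s) + (N * p * ((1 - W) * (1 - r * s) + W * (1 - r)) - W * (1 - p * r)) * (1 - g))
    (hHar : g * (a1 + a2 + d1 + d2) ≤ d1 + d2)
    (hxh : x ≤ qh) (hSx : N * x ≤ S) (hSub : S ≤ Sub) : x ≤ P := by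
  have hpr : 0 ≤ p * r := mul_nonneg hp0 hr0
  have hprs1 : p * r * s ≤ 1 := by
    have h1 : p * r ≤ 1 := by nlinarith
    nlinarith
  have id : N * g * (1 - W) * ((p * r * s * x00 + p * r * x01 + p * a1 + a2 + (1 - W) * s * c + (1 - W * (1 - s)) * d1 + d2) -
        s * (p * r * (x00 + x01 + a1 + a2 + c + d1 + d2) + (1 - p * r) * (c + d1 + d2))) +
      W * g * (N * (p * r * s * x00 + p * r * x01 + p * a1 + a2 + (1 - W) * s * c + (1 - W * (1 - s)) * d1 + d2) -
        (p * r * N * x01 + (1 - p * r + p * r * N) * a1 + N * a2 + d1 + N * d2)) +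
      (N * p * ((1 - W) * (1 - r * s) + W * (1 - r)) - W * (1 - p * r)) * (d1 + d2 - g * (a1 + a2 + d1 + d2)) =
      N * g * W * (p * r) * s * x00 + N * g * (1 - W) * (p * r) * (1 - s) * x01 +
        (N * g * (1 - W) * (1 - p * r * s) - (N * p * ((1 - W) * (1 - r * s) + W * (1 - r)) - W * (1 - p * r)) * g) * a2 +
        (g * (N * ((1 - W) ^ 2 * (1 - s) + W * (1 - W * (1 - s))) - W) +
          (N * p * ((1 - W) * (1 - r * s) + W * (1 - r)) - W * (1 - p * r)) * (1 - g)) * d1 +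
        (N * g * (1 - W) * (1 - s) + (N * p * ((1 - W) * (1 - r * s) + W * (1 - r)) - W * (1 - p * r)) * (1 - g)) * d2 := by
    subst hW; ring
  have e1 : s * (p * r * (x00 + x01 + a1 + a2 + c + d1 + d2) + (1 - p * r) * (c + d1 + d2)) = qh := by rw [hqh, hg, hone]; ring
  rw [e1, ← hP, ← hSubd] at id
  have t1 : 0 ≤ N * g * W * (p * r) * s * x00 :=
    mul_nonneg (mul_nonneg (mul_nonneg (mul_nonneg (mul_nonneg hN.le hg0.le) hW0) hpr) hs0) hx00
  have t2 : 0 ≤ N * g * (1 - W) * (p * r) * (1 - s) * x01 :=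
    mul_nonneg (mul_nonneg (mul_nonneg (mul_nonneg (mul_nonneg hN.le hg0.le) (by linarith)) hpr) (by linarith)) hx01
  have t4 : 0 ≤ (N * g * (1 - W) * (1 - p * r * s) - (N * p * ((1 - W) * (1 - r * s) + W * (1 - r)) - W * (1 - p * r)) * g) * a2 := by
    refine mul_nonneg ?_ ha2
    have h1 : 0 ≤ N * g * (1 - W) * (1 - p * r * s) := mul_nonneg (mul_nonneg (mul_nonneg hN.le hg0.le) (by linarith)) (by linarith)
    have h2 : (N * p * ((1 - W) * (1 - r * s) + W * (1 - r)) - W * (1 - p * r)) * g ≤ 0 := mul_nonpos_of_nonpos_of_nonneg hA1 hg0.le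
    linarith
  have t5 := mul_nonneg hL1 hd1
  have t6 := mul_nonneg hL2 hd2
  have tH : (N * p * ((1 - W) * (1 - r * s) + W * (1 - r)) - W * (1 - p * r)) * (d1 + d2 - g * (a1 + a2 + d1 + d2)) ≤ 0 :=
    mul_nonpos_of_nonpos_of_nonneg hA1 (by linarith)
  have hkey : 0 ≤ N * g * (1 - W) * (P - qh) + W * g * (N * P - Sub) := by linarith [id]
  have h1 : N * g * (1 - W) * (P - qh) ≤ N * g * (1 - W) * (P - x) :=
    mul_le_mul_of_nonneg_left (by linarith) (mul_nonneg (mul_nonneg hN.le hg0.le) (by linarith))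
  have h2 : W * g * (N * P - Sub) ≤ W * g * (N * P - N * x) := mul_le_mul_of_nonneg_left (by linarith) (mul_nonneg hW0 hg0.le)
  have h3 : N * g * (1 - W) * (P - x) + W * g * (N * P - N * x) = (N * g) * (P - x) := by ring
  have h4 : 0 ≤ (N * g) * (P - x) := by linarith
  have h5 := (mul_nonneg_iff_of_pos_left (mul_pos hN hg0)).1 h4
  linarith

/-- **Certificate M1**: compare `P` with `q_h`, paying with the mean: `(W + 1 − s)(P − q_h) ≥ sW(EN − 2)` coefficientwise when the five
coefficients `B₁,…,B₅` are nonnegative. [this work] -/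
theorem arith_M1 {p r s W N x S g x00 x01 a1 a2 c d1 d2 P qv qh Sub : ℝ}
    (hp0 : 0 ≤ p) (hp1 : p ≤ 1) (hr0 : 0 ≤ r) (hr1 : r ≤ 1) (hs0 : 0 ≤ s) (hs1 : s ≤ 1)
    (hW : W = (1 - p) * (1 - r)) (hW0 : 0 ≤ W)
    (hLam : 0 < W + (1 - s)) (hx00 : 0 ≤ x00) (hx01 : 0 ≤ x01) (ha1 : 0 ≤ a1) (ha2 : 0 ≤ a2) (hd1 : 0 ≤ d1) (hd2 : 0 ≤ d2)
    (hone : x00 + x01 + a1 + a2 + c + d1 + d2 = 1) (hg : g = c + d1 + d2)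
    (hP : P = p * r * s * x00 + p * r * x01 + p * a1 + a2 + (1 - W) * s * c + (1 - W * (1 - s)) * d1 + d2)
    (hqv : qv = p + (1 - p) * r * g) (hqh : qh = s * (p * r + (1 - p * r) * g))
    (hSubd : Sub = p * r * N * x01 + (1 - p * r + p * r * N) * a1 + N * a2 + d1 + N * d2)
    (hB1 : 0 ≤ (W + (1 - s)) * (p * r) * (1 - s) + s * W * (2 - p - s * (p * r) - p * r * N))
    (hB2 : 0 ≤ (W + (1 - s)) * p * (1 - r * s) + s * W * (1 + p * r - p - s * (p * r) - p * r * N))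
    (hB3 : 0 ≤ (W + (1 - s)) * (1 - p * r * s) - s * W * (N - 2 + p + s * (p * r)))
    (hB4 : 0 ≤ (W + (1 - s)) * (1 - s) * (1 - W) + s * W * (W - s))
    (hB5 : 0 ≤ (W + (1 - s)) * (1 - s + s * W) - N * s * W)
    (hxh : x ≤ qh) (hSub : S ≤ Sub) (hEN : 2 < qv + qh + S) : x ≤ P := by
  have hpr : 0 ≤ p * r := mul_nonneg hp0 hr0
  have hps : s * (p * r) ≤ 1 := by
    have h1 : p * r ≤ 1 := by nlinarith
    nlinarith
  have id : (W + (1 - s)) * ((p * r * s * x00 + p * r * x01 + p * a1 + a2 + (1 - W) * s * c + (1 - W * (1 - s)) * d1 + d2) -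
        s * (p * r * (x00 + x01 + a1 + a2 + c + d1 + d2) + (1 - p * r) * (c + d1 + d2))) -
      s * W * ((p * (x00 + x01 + a1 + a2 + c + d1 + d2) + (1 - p) * r * (c + d1 + d2)) +
        s * (p * r * (x00 + x01 + a1 + a2 + c + d1 + d2) + (1 - p * r) * (c + d1 + d2)) +
        (p * r * N * x01 + (1 - p * r + p * r * N) * a1 + N * a2 + d1 + N * d2) - 2 * (x00 + x01 + a1 + a2 + c + d1 + d2)) =
      s * W * (2 - p - s * (p * r)) * x00 + ((W + (1 - s)) * (p * r) * (1 - s) + s * W * (2 - p - s * (p * r) - p * r * N)) * x01 +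
        ((W + (1 - s)) * p * (1 - r * s) + s * W * (1 + p * r - p - s * (p * r) - p * r * N)) * a1 +
        ((W + (1 - s)) * (1 - p * r * s) - s * W * (N - 2 + p + s * (p * r))) * a2 +
        ((W + (1 - s)) * (1 - s) * (1 - W) + s * W * (W - s)) * d1 + ((W + (1 - s)) * (1 - s + s * W) - N * s * W) * d2 := by
    subst hW; ring
  have e1 : s * (p * r * (x00 + x01 + a1 + a2 + c + d1 + d2) + (1 - p * r) * (c + d1 + d2)) = qh := by rw [hqh, hg, hone]; ring
  have e2 : p * (x00 + x01 + a1 + a2 + c + d1 + d2) + (1 - p) * r * (c + d1 + d2) = qv := by rw [hqv, hg, hone]; ring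
  rw [e1, e2, hone, ← hP, ← hSubd] at id
  have t1 : 0 ≤ s * W * (2 - p - s * (p * r)) * x00 := mul_nonneg (mul_nonneg (mul_nonneg hs0 hW0) (by linarith)) hx00
  have t2 := mul_nonneg hB1 hx01
  have t3 := mul_nonneg hB2 ha1
  have t4 := mul_nonneg hB3 ha2
  have t5 := mul_nonneg hB4 hd1
  have t6 := mul_nonneg hB5 hd2
  have hkey : 0 ≤ (W + (1 - s)) * (P - qh) - s * W * (qv + qh + Sub - 2 * 1) := by rw [id]; linarith
  have hm : 0 ≤ s * W * (qv + qh + Sub - 2 * 1) := mul_nonneg (mul_nonneg hs0 hW0) (by linarith)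
  have h1 : 0 ≤ (W + (1 - s)) * (P - qh) := by linarith
  have h2 := (mul_nonneg_iff_of_pos_left hLam).1 h1
  linarith

/-- **Certificate M3** (`N ≥ 2` outside relays; regime `g` small): compare `P` with `q_v`, paying with the mean and with the mass of the
cell `c ≤ g`: `N(1−g)(P − q_v) − (1−g)Φ(EN − 2) − K̃·((c + d₁ + d₂) − g) ≥ 0` coefficientwise, when the coefficients `Y₀₀, Y₀₁, Y_{a₁}, Y_{a₂}`
and `D` are nonnegative (`Φ = 1 − s + sW`, `K̃ = Φ(W + 1 − s) − N(1−s)(1−W)`). [this work] -/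
theorem arith_M3 {p r s W N x S g x00 x01 a1 a2 c d1 d2 P qv qh Sub : ℝ}
    (hW : W = (1 - p) * (1 - r))
    (hN : 0 < N) (hx00 : 0 ≤ x00) (hx01 : 0 ≤ x01) (ha1 : 0 ≤ a1) (ha2 : 0 ≤ a2) (hd1 : 0 ≤ d1)
    (hone : x00 + x01 + a1 + a2 + c + d1 + d2 = 1) (hg : g = c + d1 + d2) (hg1 : g < 1)
    (hP : P = p * r * s * x00 + p * r * x01 + p * a1 + a2 + (1 - W) * s * c + (1 - W * (1 - s)) * d1 + d2)
    (hqv : qv = p + (1 - p) * r * g) (hqh : qh = s * (p * r + (1 - p * r) * g))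
    (hSubd : Sub = p * r * N * x01 + (1 - p * r + p * r * N) * a1 + N * a2 + d1 + N * d2)
    (hPhi : 0 ≤ 1 - s + s * W)
    (hY00 : 0 ≤ (1 - g) * ((1 - s + s * W) * (2 - p - s * (p * r)) - N * p * (1 - r * s)) +
      g * ((1 - s + s * W) * (W + (1 - s)) - N * (1 - s) * (1 - W)))
    (hY01 : 0 ≤ (1 - g) * ((1 - s + s * W) * (2 - p - s * (p * r) - p * r * N) - N * p * (1 - r)) +
      g * ((1 - s + s * W) * (W + (1 - s)) - N * (1 - s) * (1 - W)))
    (hYA1 : 0 ≤ (1 - g) * (1 - s + s * W) * (1 + p * r - p - s * (p * r) - p * r * N) +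
      g * ((1 - s + s * W) * (W + (1 - s)) - N * (1 - s) * (1 - W)))
    (hYA2 : 0 ≤ (1 - g) * (N * (1 - p) - (1 - s + s * W) * (N - 2 + p + s * (p * r))) +
      g * ((1 - s + s * W) * (W + (1 - s)) - N * (1 - s) * (1 - W)))
    (hD : 0 ≤ (N - 1) * (1 - s + s * W) - N * (1 - s) * W)
    (hxv : x ≤ qv) (hSub : S ≤ Sub) (hEN : 2 < qv + qh + S) : x ≤ P := by
  have id : N * (1 - g) * ((p * r * s * x00 + p * r * x01 + p * a1 + a2 + (1 - W) * s * c + (1 - W * (1 - s)) * d1 + d2) -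
        (p * (x00 + x01 + a1 + a2 + c + d1 + d2) + (1 - p) * r * (c + d1 + d2))) -
      (1 - g) * (1 - s + s * W) * ((p * (x00 + x01 + a1 + a2 + c + d1 + d2) + (1 - p) * r * (c + d1 + d2)) +
        s * (p * r * (x00 + x01 + a1 + a2 + c + d1 + d2) + (1 - p * r) * (c + d1 + d2)) +
        (p * r * N * x01 + (1 - p * r + p * r * N) * a1 + N * a2 + d1 + N * d2) - 2 * (x00 + x01 + a1 + a2 + c + d1 + d2)) -
      ((1 - s + s * W) * (W + (1 - s)) - N * (1 - s) * (1 - W)) * ((c + d1 + d2) - g * (x00 + x01 + a1 + a2 + c + d1 + d2)) =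
      ((1 - g) * ((1 - s + s * W) * (2 - p - s * (p * r)) - N * p * (1 - r * s)) +
          g * ((1 - s + s * W) * (W + (1 - s)) - N * (1 - s) * (1 - W))) * x00 +
        ((1 - g) * ((1 - s + s * W) * (2 - p - s * (p * r) - p * r * N) - N * p * (1 - r)) +
          g * ((1 - s + s * W) * (W + (1 - s)) - N * (1 - s) * (1 - W))) * x01 +
        ((1 - g) * (1 - s + s * W) * (1 + p * r - p - s * (p * r) - p * r * N) +
          g * ((1 - s + s * W) * (W + (1 - s)) - N * (1 - s) * (1 - W))) * a1 +
        ((1 - g) * (N * (1 - p) - (1 - s + s * W) * (N - 2 + p + s * (p * r))) +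
          g * ((1 - s + s * W) * (W + (1 - s)) - N * (1 - s) * (1 - W))) * a2 +
        (1 - g) * ((N - 1) * (1 - s + s * W) - N * (1 - s) * W) * d1 := by
    subst hW; ring
  have e1 : s * (p * r * (x00 + x01 + a1 + a2 + c + d1 + d2) + (1 - p * r) * (c + d1 + d2)) = qh := by rw [hqh, hg, hone]; ring
  have e2 : p * (x00 + x01 + a1 + a2 + c + d1 + d2) + (1 - p) * r * (c + d1 + d2) = qv := by rw [hqv, hg, hone]; ring
  have e3 : (c + d1 + d2) - g * (x00 + x01 + a1 + a2 + c + d1 + d2) = 0 := by rw [hone, ← hg]; ring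
  rw [e1, e2, e3, hone, mul_zero, sub_zero, ← hP, ← hSubd] at id
  have t1 := mul_nonneg hY00 hx00
  have t2 := mul_nonneg hY01 hx01
  have t3 := mul_nonneg hYA1 ha1
  have t4 := mul_nonneg hYA2 ha2
  have t5 : 0 ≤ (1 - g) * ((N - 1) * (1 - s + s * W) - N * (1 - s) * W) * d1 := mul_nonneg (mul_nonneg (by linarith) hD) hd1
  have hkey : 0 ≤ N * (1 - g) * (P - qv) - (1 - g) * (1 - s + s * W) * (qv + qh + Sub - 2 * 1) := by rw [id]; linarith
  have hm : 0 ≤ (1 - g) * (1 - s + s * W) * (qv + qh + Sub - 2 * 1) := mul_nonneg (mul_nonneg (by linarith) hPhi) (by linarith)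
  have h1 : 0 ≤ (N * (1 - g)) * (P - qv) := by linarith
  have h2 := (mul_nonneg_iff_of_pos_left (mul_pos hN (by linarith : (0:ℝ) < 1 - g))).1 h1
  linarith

/-- **Certificate M3 for one outside relay** (`N = 1`, so the cells `a₂ = d₂` are empty): compare `P` with `q_v`, with multiplier
`λ′ = (1−s)(1−W) + sW` on the mean and the mass of `c`. [this work] -/
theorem arith_M3one {p r s W x S g x00 x01 a1 c d1 P qv qh Sub : ℝ}
    (hW : W = (1 - p) * (1 - r))
    (hx00 : 0 ≤ x00) (hx01 : 0 ≤ x01) (ha1 : 0 ≤ a1)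
    (hone : x00 + x01 + a1 + c + d1 = 1) (hg : g = c + d1) (hg1 : g < 1)
    (hP : P = p * r * s * x00 + p * r * x01 + p * a1 + (1 - W) * s * c + (1 - W * (1 - s)) * d1)
    (hqv : qv = p + (1 - p) * r * g) (hqh : qh = s * (p * r + (1 - p * r) * g)) (hSubd : Sub = p * r * x01 + a1 + d1)
    (hlam : 0 ≤ (1 - s) * (1 - W) + s * W)
    (hZ00 : 0 ≤ (1 - g) * (-(p * (1 - r * s)) + ((1 - s) * (1 - W) + s * W) * (2 - p - s * (p * r))) +
      g * (((1 - s) * (1 - W) + s * W) * (W + (1 - s)) - (1 - s) * (1 - W)))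
    (hZ01 : 0 ≤ (1 - g) * (-(p * (1 - r)) + ((1 - s) * (1 - W) + s * W) * (2 - p - s * (p * r) - p * r)) +
      g * (((1 - s) * (1 - W) + s * W) * (W + (1 - s)) - (1 - s) * (1 - W)))
    (hZA1 : 0 ≤ (1 - g) * ((1 - s) * (1 - W) + s * W) * (1 - p - s * (p * r)) +
      g * (((1 - s) * (1 - W) + s * W) * (W + (1 - s)) - (1 - s) * (1 - W)))
    (hxv : x ≤ qv) (hSub : S ≤ Sub) (hEN : 2 < qv + qh + S) : x ≤ P := by
  have id : (1 - g) * ((p * r * s * x00 + p * r * x01 + p * a1 + (1 - W) * s * c + (1 - W * (1 - s)) * d1) -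
        (p * (x00 + x01 + a1 + c + d1) + (1 - p) * r * (c + d1))) -
      (1 - g) * ((1 - s) * (1 - W) + s * W) * ((p * (x00 + x01 + a1 + c + d1) + (1 - p) * r * (c + d1)) +
        s * (p * r * (x00 + x01 + a1 + c + d1) + (1 - p * r) * (c + d1)) + (p * r * x01 + a1 + d1) - 2 * (x00 + x01 + a1 + c + d1)) -
      (((1 - s) * (1 - W) + s * W) * (W + (1 - s)) - (1 - s) * (1 - W)) * ((c + d1) - g * (x00 + x01 + a1 + c + d1)) =
      ((1 - g) * (-(p * (1 - r * s)) + ((1 - s) * (1 - W) + s * W) * (2 - p - s * (p * r))) +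
          g * (((1 - s) * (1 - W) + s * W) * (W + (1 - s)) - (1 - s) * (1 - W))) * x00 +
        ((1 - g) * (-(p * (1 - r)) + ((1 - s) * (1 - W) + s * W) * (2 - p - s * (p * r) - p * r)) +
          g * (((1 - s) * (1 - W) + s * W) * (W + (1 - s)) - (1 - s) * (1 - W))) * x01 +
        ((1 - g) * ((1 - s) * (1 - W) + s * W) * (1 - p - s * (p * r)) +
          g * (((1 - s) * (1 - W) + s * W) * (W + (1 - s)) - (1 - s) * (1 - W))) * a1 := by
    subst hW; ring
  have e1 : s * (p * r * (x00 + x01 + a1 + c + d1) + (1 - p * r) * (c + d1)) = qh := by rw [hqh, hg, hone]; ring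
  have e2 : p * (x00 + x01 + a1 + c + d1) + (1 - p) * r * (c + d1) = qv := by rw [hqv, hg, hone]; ring
  have e3 : (c + d1) - g * (x00 + x01 + a1 + c + d1) = 0 := by rw [hone, ← hg]; ring
  rw [e1, e2, e3, hone, mul_zero, sub_zero, ← hP, ← hSubd] at id
  have t1 := mul_nonneg hZ00 hx00
  have t2 := mul_nonneg hZ01 hx01
  have t3 := mul_nonneg hZA1 ha1
  have hkey : 0 ≤ (1 - g) * (P - qv) - (1 - g) * ((1 - s) * (1 - W) + s * W) * (qv + qh + Sub - 2 * 1) := by rw [id]; linarith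
  have hm : 0 ≤ (1 - g) * ((1 - s) * (1 - W) + s * W) * (qv + qh + Sub - 2 * 1) :=
    mul_nonneg (mul_nonneg (by linarith) hlam) (by linarith)
  have h1 : 0 ≤ (1 - g) * (P - qv) := by linarith
  have h2 := (mul_nonneg_iff_of_pos_left (by linarith : (0:ℝ) < 1 - g)).1 h1
  linarith

/-- **The corner `g = 1` with one outside relay** (all mass on the cells `c, d₁`): `(W + 1 − s)(P − q_v) ≥ (1−s)(1−W)(EN − 2)`
when `(W + 1 − s)·s·W ≥ (1−s)(1−W)(s − W)`. [this work] -/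
theorem arith_M3top {p r s W x S c d1 P qv qh Sub : ℝ}
    (hW : W = (1 - p) * (1 - r)) (hW1 : W ≤ 1) (hs1 : s ≤ 1) (hLam : 0 < W + (1 - s)) (hd1 : 0 ≤ d1)
    (hone : c + d1 = 1)
    (hP : P = (1 - W) * s * c + (1 - W * (1 - s)) * d1)
    (hqv : qv = p + (1 - p) * r * 1) (hqh : qh = s * (p * r + (1 - p * r) * 1)) (hSubd : Sub = d1)
    (hI : 0 ≤ (W + (1 - s)) * s * W - (1 - s) * (1 - W) * (s - W))
    (hxv : x ≤ qv) (hSub : S ≤ Sub) (hEN : 2 < qv + qh + S) : x ≤ P := by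
  have id : (W + (1 - s)) * (((1 - W) * s * c + (1 - W * (1 - s)) * d1) - (p * (c + d1) + (1 - p) * r * (c + d1))) -
      (1 - s) * (1 - W) * ((p * (c + d1) + (1 - p) * r * (c + d1)) + s * (p * r * (c + d1) + (1 - p * r) * (c + d1)) + d1 -
        2 * (c + d1)) = ((W + (1 - s)) * s * W - (1 - s) * (1 - W) * (s - W)) * d1 := by
    subst hW; ring
  have e1 : s * (p * r * (c + d1) + (1 - p * r) * (c + d1)) = qh := by rw [hqh, hone]; ring
  have e2 : p * (c + d1) + (1 - p) * r * (c + d1) = qv := by rw [hqv, hone]; ring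
  rw [e1, e2, hone, ← hP] at id
  have t := mul_nonneg hI hd1
  have hSd : S ≤ d1 := by rw [← hSubd]; exact hSub
  have hm : 0 ≤ (1 - s) * (1 - W) * (qv + qh + d1 - 2 * 1) := mul_nonneg (mul_nonneg (by linarith) (by linarith)) (by linarith)
  have h1 : 0 ≤ (W + (1 - s)) * (P - qv) := by linarith
  have h2 := (mul_nonneg_iff_of_pos_left hLam).1 h1
  linarith

end EarHair

end Quant

end Summit.CriticalPhenomena.PercolationContinuityZ3.Theorems
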